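import Summits.CriticalPhenomena.PercolationContinuityZ3.Theorems.PercNearOneGluingNoHeavyLowerTailSahiCombTriWSwapPair

/-!
# `a = 2`: the SWAP-ORBIT sum `TRI(P;F,G) + TRI(P;F,G^{swap}) ≥ 0` — eight Kleitman gaps and two five-up-sets

Support file of the one-cut programme (crux `NoHeavyLowerTail`, stmt-CriticalPhenomena-4575; cell `prim-masterthm`, seat P5 gen 21; memo
`FROM-prim-masterthm-p5-g21-SELF-DUAL-AND-FACES.md` §8).

For an index cube with two coordinates `a ≠ b`, swapping the two MIDDLE levels of a monotone family of up-sets, `G^{swap} x := G (x.image (Equiv.swap a b))`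
(so `G^{swap} {a} = G {b}`, `G^{swap} {b} = G {a}`, bottom and top unchanged), is again a monotone family.  The thin-edge functional of a level pair satisfies the
exact cancellation
  `triWOne(P; A, A'; B, B') + triWOne(P; A, A'; B', B) = Σ_{X ∈ {A,A'}, Y ∈ {B,B'}} ( [#(P∩X∩Y) − #(P∩refl X∩Y)] + [#(P∩X∩Y) − #(P∩X∩refl Y)] )`
(the doubly-antipodal counts cancel in the sum), i.e. EIGHT Kleitman gaps (`triWOne_add_swap_nonneg`), for ARBITRARY up-sets `A, A', B, B'`.  With the pair decomposition
`2·triW = Σ_x triWOne(x-pair)` this gives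

* **`FiveUpSet.triW_add_triW_swap_nonneg`** — `0 ≤ triW P F G + triW P F G^{swap}` for every up-set `P` and all monotone families of up-sets `F, G` on a
  two-coordinate index cube: the two crossed pairs pair up into eight Kleitman gaps, the two nested pairs are five-up-set instances (`triWOne_nonneg_cube`).
So `TriWIneq` for `a = 2` is equivalent to `|triW P F G − triW P F G^{swap}| ≤ triW P F G + triW P F G^{swap}`: the ORIENTATION part
`Or = ½(triW P F G − triW P F G^{swap})` (which middle level carries which point) against the swap-symmetric part (memo §7–§8: `Σ = triWOne(nested) + ½·Occ`).
The stratum `G {a} = G {b}` (`G = G^{swap}`) of `…SahiCombTriWSwapPair` is the fixed-point case.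
HONEST LABEL: unconditional (std axioms); the orientation bound itself (= `TriWIneq`, `a = 2`) remains OPEN. [this work]
-/

namespace Summit.CriticalPhenomena.PercolationContinuityZ3.Theorems

namespace FiveUpSet

open Finset

variable {β γ : Type} [DecidableEq β] [Fintype β] [DecidableEq γ] [Fintype γ]

omit [DecidableEq β] [Fintype β] in
/-- **Swap cancellation.**  For arbitrary up-sets `P, A, A', B, B'`:
`0 ≤ triWOne(P; A, A'; B, B') + triWOne(P; A, A'; B', B)` — the sum is eight Kleitman gaps (the doubly-antipodal counts cancel). [this work] -/
theorem triWOne_add_swap_nonneg (P A A' B B' : Finset (Finset γ)) (hP : IsUpperSet (P : Set (Finset γ)))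
    (hA : IsUpperSet (A : Set (Finset γ))) (hA' : IsUpperSet (A' : Set (Finset γ)))
    (hB : IsUpperSet (B : Set (Finset γ))) (hB' : IsUpperSet (B' : Set (Finset γ))) :
    0 ≤ LatticeFiveUpSet.triWOne (complEquiv γ) P A A' B B' + LatticeFiveUpSet.triWOne (complEquiv γ) P A A' B' B := by
  unfold LatticeFiveUpSet.triWOne
  simp only [image_complEquiv]
  have hPA : IsUpperSet ((P ∩ A : Finset (Finset γ)) : Set (Finset γ)) := by rw [coe_inter]; exact hP.inter hA
  have hPA' : IsUpperSet ((P ∩ A' : Finset (Finset γ)) : Set (Finset γ)) := by rw [coe_inter]; exact hP.inter hA'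
  have hPB : IsUpperSet ((P ∩ B : Finset (Finset γ)) : Set (Finset γ)) := by rw [coe_inter]; exact hP.inter hB
  have hPB' : IsUpperSet ((P ∩ B' : Finset (Finset γ)) : Set (Finset γ)) := by rw [coe_inter]; exact hP.inter hB'
  -- eight Kleitman gaps: X ∈ {A, A'}, Y ∈ {B, B'}
  have k1 : (P ∩ B ∩ refl A).card ≤ (P ∩ B ∩ A).card := card_inter_refl_le hPB hA
  have k2 : (P ∩ A ∩ refl B).card ≤ (P ∩ A ∩ B).card := card_inter_refl_le hPA hB
  have k3 : (P ∩ B' ∩ refl A).card ≤ (P ∩ B' ∩ A).card := card_inter_refl_le hPB' hA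
  have k4 : (P ∩ A ∩ refl B').card ≤ (P ∩ A ∩ B').card := card_inter_refl_le hPA hB'
  have k5 : (P ∩ B ∩ refl A').card ≤ (P ∩ B ∩ A').card := card_inter_refl_le hPB hA'
  have k6 : (P ∩ A' ∩ refl B).card ≤ (P ∩ A' ∩ B).card := card_inter_refl_le hPA' hB
  have k7 : (P ∩ B' ∩ refl A').card ≤ (P ∩ B' ∩ A').card := card_inter_refl_le hPB' hA'
  have k8 : (P ∩ A' ∩ refl B').card ≤ (P ∩ A' ∩ B').card := card_inter_refl_le hPA' hB'
  simp only [inter_right_comm _ B, inter_right_comm _ B'] at k1 k3 k5 k7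
  omega

/-- **`a = 2`: the swap-orbit sum is non-negative.**  On a two-coordinate index cube `{a, b}`, for every up-set `P` and all monotone families of up-sets
`F, G`: `0 ≤ triW P F G + triW P F G^{swap}` with `G^{swap} x = G (x.image (Equiv.swap a b))` (middle levels exchanged).  The crossed level pairs of the two
summands combine into eight Kleitman gaps (`triWOne_add_swap_nonneg`); the nested pairs are five-up-set instances. [this work] -/
theorem triW_add_triW_swap_nonneg {a b : β} (hab : a ≠ b) (hu : (univ : Finset β) = {a, b})
    (P : Finset (Finset γ)) (F G : Finset β → Finset (Finset γ))
    (hP : IsUpperSet (P : Set (Finset γ))) (hF : ∀ x, IsUpperSet (F x : Set (Finset γ))) (hG : ∀ x, IsUpperSet (G x : Set (Finset γ)))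
    (hFm : Monotone F) (hGm : Monotone G) :
    0 ≤ triW P F G + triW P F (fun x => G (x.image (Equiv.swap a b))) := by
  set G' : Finset β → Finset (Finset γ) := fun x => G (x.image (Equiv.swap a b)) with hG'def
  have hca : ({a} : Finset β)ᶜ = {b} := compl_singleton_eq_of_univ hab hu
  have hcb : ({b} : Finset β)ᶜ = {a} := by rw [← hca, compl_compl]
  -- values of the swapped family
  have Ga : G' {a} = G {b} := by
    simp only [hG'def, image_singleton, Equiv.swap_apply_left]
  have Gb : G' {b} = G {a} := by
    simp only [hG'def, image_singleton, Equiv.swap_apply_right]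
  have G0 : G' ∅ = G ∅ := by
    simp only [hG'def, image_empty]
  have G1 : G' univ = G univ := by
    simp only [hG'def, image_univ_equiv]
  -- the doubled sum, pair by pair
  have h2 : 0 ≤ 2 * triW P F G + 2 * triW P F G' := by
    rw [two_mul_triW, two_mul_triW, ← sum_add_distrib]
    refine sum_nonneg fun x _ => ?_
    rcases eq_of_univ_pair hu x with rfl | rfl | rfl | rfl
    · -- nested pair (∅, univ), twice
      rw [compl_empty, G0, G1]
      have hn := triWOne_nonneg_cube γ P (F ∅) (F univ) (G ∅) (G univ) hP (hF ∅) (hF univ) (hG ∅) (hG univ)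
        (hFm (empty_subset _)) (hGm (empty_subset _))
      have e : LatticeFiveUpSet.triWOne (complEquiv γ) P (F ∅) (F univ) (G ∅) (G univ)
          = LatticeFiveUpSet.triWOne (⟨compl, compl, compl_compl, compl_compl⟩ : Finset γ ≃ Finset γ) P (F ∅) (F univ) (G ∅) (G univ) := rfl
      linarith
    · -- crossed pair ({a}, {b}) of G and of G^{swap}
      rw [hca, Ga, Gb]
      exact triWOne_add_swap_nonneg P (F {a}) (F {b}) (G {a}) (G {b}) hP (hF {a}) (hF {b}) (hG {a}) (hG {b})
    · rw [hcb, Ga, Gb]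
      exact triWOne_add_swap_nonneg P (F {b}) (F {a}) (G {b}) (G {a}) hP (hF {b}) (hF {a}) (hG {b}) (hG {a})
    · rw [compl_univ, G0, G1]
      have hn := triWOne_nonneg_cube γ P (F ∅) (F univ) (G ∅) (G univ) hP (hF ∅) (hF univ) (hG ∅) (hG univ)
        (hFm (empty_subset _)) (hGm (empty_subset _))
      have hsym : LatticeFiveUpSet.triWOne (complEquiv γ) P (F univ) (F ∅) (G univ) (G ∅)
          = LatticeFiveUpSet.triWOne (complEquiv γ) P (F ∅) (F univ) (G ∅) (G univ) := by
        unfold LatticeFiveUpSet.triWOne; ring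
      have e : LatticeFiveUpSet.triWOne (complEquiv γ) P (F ∅) (F univ) (G ∅) (G univ)
          = LatticeFiveUpSet.triWOne (⟨compl, compl, compl_compl, compl_compl⟩ : Finset γ ≃ Finset γ) P (F ∅) (F univ) (G ∅) (G univ) := rfl
      rw [hsym]
      linarith
  linarith

end FiveUpSet

end Summit.CriticalPhenomena.PercolationContinuityZ3.Theorems
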